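import Summits.BirchSwinnertonDyer.BirchSwinnertonDyer.Theorems.ManinLocalTwoThreeProductCertsOneThirtyTwoBB
import HarnessLib

/-!
# Level 132, class `132b` (weight 4): product certificates, part C

Cell `bsd-f2-manin`, route `ManinLocalTwoThree`, cruxes C2 `ManinOddAtFour` (stmt-BirchSwinnertonDyer-22967) / C3 `ManinPrimeToThreeAtNine` (stmt-22968); prover seat p2 gen 31;
`--supports` (helper).  WEIGHT-4 BRACKET–STURM for the class `132b` (optimal curve `132b1 = [0, -1, 0, -77, 330]`, `deg φ` too large for a weight-2 presentation):
`x∘φ = A/B` with `A = Σ_p alphaB_p · C_{i_p}·C_{j_p}`, `B = Σ_p betaB_p · C_{i_p}·C_{j_p}` over `78` products of an's `30` basis `η`-quotients of `M₂(Γ₀(132))`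
(exact linear algebra + LLL, seat p2 gen 31; the weight-`20` defect `216[A,B]² − F²(864A³ − 18c₄AB² − c₆B³)B` vanishes mod `q^482`, Sturm bound `480`).
HONEST FRAMING: kernel-checked identities of integer lists / elementary bookkeeping (standard axioms); nothing here proves C2/C3 for any `N`, Manin's conjecture or BSD.
[cite: Sturm1987, Thm. 1] [cite: AgasheRibetStein2006, §§1–2] [cite: Koehler2011, §2.1]
-/

set_option autoImplicit false
-- lint-debt: the directory name repeats the summit name (sibling precedent `ManinLocalTwoThreeManinConstantEightyEight.lean`)
set_option linter.dupNamespace false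

noncomputable section

open Complex
open UpperHalfPlane hiding I
open scoped MatrixGroups ModularForm
open ModularForm CongruenceSubgroup PowerSeries
open Literature.NumberTheory.ModularForms
open Literature.NumberTheory.EllipticCurves Literature.NumberTheory.EllipticCurves.ModularForms

namespace Summit.BirchSwinnertonDyer.BirchSwinnertonDyer.Theorems.ManinLocalTwoThree.LevelOneThirtyTwo

open Summit.BirchSwinnertonDyer.BirchSwinnertonDyer.Theorems.ManinLocalTwoThree.BracketSturm Summit.BirchSwinnertonDyer.BirchSwinnertonDyer.Theorems.ManinLocalTwoThree.PinningKernel Summit.BirchSwinnertonDyer.BirchSwinnertonDyer.Theorems.ManinLocalTwoThree.PinningOneThirtyTwo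
open Literature.NumberTheory.EllipticCurves.Rank1Residual.X11RankOneCertificates (discOf c4Of c6Of)

set_option maxHeartbeats 4000000
set_option maxRecDepth 16384

/-! ## Product certificates `26 … 38` -/

/-- `pTB 26 = tabsDeep 0 * tabsDeep 26` below `482` (kernel `decide`). [folklore] -/
theorem hpTB26 : mulList 482 (tabsDeep 0) (tabsDeep 26) = pTB 26 := by
  decide +kernel

/-- The table `pTB 26` agrees below `482` with the `q`-expansion of the weight-`4` form `C_0·C_26`. [folklore] -/
theorem hGB26 {C : Fin 30 → ModularForm (Gamma0 132) 2}
    (hi : ∀ n < 482, (((tabsDeep 0).getD n 0 : ℤ) : ℂ) = (qExpansion 1 ⇑(C 0)).coeff n)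
    (hj : ∀ n < 482, (((tabsDeep 26).getD n 0 : ℤ) : ℂ) = (qExpansion 1 ⇑(C 26)).coeff n) :
    ∀ n < 482, (((pTB 26).getD n 0 : ℤ) : ℂ) = (qExpansion 1 ⇑((C 0).mul (C 26))).coeff n := by
  rw [← hpTB26]; exact qExpansion_coeff_mul_eq_mulList (C 0) (C 26) hi hj

/-- `pTB 27 = tabsDeep 0 * tabsDeep 27` below `482` (kernel `decide`). [folklore] -/
theorem hpTB27 : mulList 482 (tabsDeep 0) (tabsDeep 27) = pTB 27 := by
  decide +kernel

/-- The table `pTB 27` agrees below `482` with the `q`-expansion of the weight-`4` form `C_0·C_27`. [folklore] -/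
theorem hGB27 {C : Fin 30 → ModularForm (Gamma0 132) 2}
    (hi : ∀ n < 482, (((tabsDeep 0).getD n 0 : ℤ) : ℂ) = (qExpansion 1 ⇑(C 0)).coeff n)
    (hj : ∀ n < 482, (((tabsDeep 27).getD n 0 : ℤ) : ℂ) = (qExpansion 1 ⇑(C 27)).coeff n) :
    ∀ n < 482, (((pTB 27).getD n 0 : ℤ) : ℂ) = (qExpansion 1 ⇑((C 0).mul (C 27))).coeff n := by
  rw [← hpTB27]; exact qExpansion_coeff_mul_eq_mulList (C 0) (C 27) hi hj

/-- `pTB 28 = tabsDeep 0 * tabsDeep 28` below `482` (kernel `decide`). [folklore] -/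
theorem hpTB28 : mulList 482 (tabsDeep 0) (tabsDeep 28) = pTB 28 := by
  decide +kernel

/-- The table `pTB 28` agrees below `482` with the `q`-expansion of the weight-`4` form `C_0·C_28`. [folklore] -/
theorem hGB28 {C : Fin 30 → ModularForm (Gamma0 132) 2}
    (hi : ∀ n < 482, (((tabsDeep 0).getD n 0 : ℤ) : ℂ) = (qExpansion 1 ⇑(C 0)).coeff n)
    (hj : ∀ n < 482, (((tabsDeep 28).getD n 0 : ℤ) : ℂ) = (qExpansion 1 ⇑(C 28)).coeff n) :
    ∀ n < 482, (((pTB 28).getD n 0 : ℤ) : ℂ) = (qExpansion 1 ⇑((C 0).mul (C 28))).coeff n := by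
  rw [← hpTB28]; exact qExpansion_coeff_mul_eq_mulList (C 0) (C 28) hi hj

/-- `pTB 29 = tabsDeep 0 * tabsDeep 29` below `482` (kernel `decide`). [folklore] -/
theorem hpTB29 : mulList 482 (tabsDeep 0) (tabsDeep 29) = pTB 29 := by
  decide +kernel

/-- The table `pTB 29` agrees below `482` with the `q`-expansion of the weight-`4` form `C_0·C_29`. [folklore] -/
theorem hGB29 {C : Fin 30 → ModularForm (Gamma0 132) 2}
    (hi : ∀ n < 482, (((tabsDeep 0).getD n 0 : ℤ) : ℂ) = (qExpansion 1 ⇑(C 0)).coeff n)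
    (hj : ∀ n < 482, (((tabsDeep 29).getD n 0 : ℤ) : ℂ) = (qExpansion 1 ⇑(C 29)).coeff n) :
    ∀ n < 482, (((pTB 29).getD n 0 : ℤ) : ℂ) = (qExpansion 1 ⇑((C 0).mul (C 29))).coeff n := by
  rw [← hpTB29]; exact qExpansion_coeff_mul_eq_mulList (C 0) (C 29) hi hj

/-- `pTB 30 = tabsDeep 1 * tabsDeep 1` below `482` (kernel `decide`). [folklore] -/
theorem hpTB30 : mulList 482 (tabsDeep 1) (tabsDeep 1) = pTB 30 := by
  decide +kernel

/-- The table `pTB 30` agrees below `482` with the `q`-expansion of the weight-`4` form `C_1·C_1`. [folklore] -/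
theorem hGB30 {C : Fin 30 → ModularForm (Gamma0 132) 2}
    (hi : ∀ n < 482, (((tabsDeep 1).getD n 0 : ℤ) : ℂ) = (qExpansion 1 ⇑(C 1)).coeff n)
    (hj : ∀ n < 482, (((tabsDeep 1).getD n 0 : ℤ) : ℂ) = (qExpansion 1 ⇑(C 1)).coeff n) :
    ∀ n < 482, (((pTB 30).getD n 0 : ℤ) : ℂ) = (qExpansion 1 ⇑((C 1).mul (C 1))).coeff n := by
  rw [← hpTB30]; exact qExpansion_coeff_mul_eq_mulList (C 1) (C 1) hi hj

/-- `pTB 31 = tabsDeep 1 * tabsDeep 2` below `482` (kernel `decide`). [folklore] -/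
theorem hpTB31 : mulList 482 (tabsDeep 1) (tabsDeep 2) = pTB 31 := by
  decide +kernel

/-- The table `pTB 31` agrees below `482` with the `q`-expansion of the weight-`4` form `C_1·C_2`. [folklore] -/
theorem hGB31 {C : Fin 30 → ModularForm (Gamma0 132) 2}
    (hi : ∀ n < 482, (((tabsDeep 1).getD n 0 : ℤ) : ℂ) = (qExpansion 1 ⇑(C 1)).coeff n)
    (hj : ∀ n < 482, (((tabsDeep 2).getD n 0 : ℤ) : ℂ) = (qExpansion 1 ⇑(C 2)).coeff n) :
    ∀ n < 482, (((pTB 31).getD n 0 : ℤ) : ℂ) = (qExpansion 1 ⇑((C 1).mul (C 2))).coeff n := by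
  rw [← hpTB31]; exact qExpansion_coeff_mul_eq_mulList (C 1) (C 2) hi hj

/-- `pTB 32 = tabsDeep 1 * tabsDeep 3` below `482` (kernel `decide`). [folklore] -/
theorem hpTB32 : mulList 482 (tabsDeep 1) (tabsDeep 3) = pTB 32 := by
  decide +kernel

/-- The table `pTB 32` agrees below `482` with the `q`-expansion of the weight-`4` form `C_1·C_3`. [folklore] -/
theorem hGB32 {C : Fin 30 → ModularForm (Gamma0 132) 2}
    (hi : ∀ n < 482, (((tabsDeep 1).getD n 0 : ℤ) : ℂ) = (qExpansion 1 ⇑(C 1)).coeff n)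
    (hj : ∀ n < 482, (((tabsDeep 3).getD n 0 : ℤ) : ℂ) = (qExpansion 1 ⇑(C 3)).coeff n) :
    ∀ n < 482, (((pTB 32).getD n 0 : ℤ) : ℂ) = (qExpansion 1 ⇑((C 1).mul (C 3))).coeff n := by
  rw [← hpTB32]; exact qExpansion_coeff_mul_eq_mulList (C 1) (C 3) hi hj

/-- `pTB 33 = tabsDeep 1 * tabsDeep 4` below `482` (kernel `decide`). [folklore] -/
theorem hpTB33 : mulList 482 (tabsDeep 1) (tabsDeep 4) = pTB 33 := by
  decide +kernel

/-- The table `pTB 33` agrees below `482` with the `q`-expansion of the weight-`4` form `C_1·C_4`. [folklore] -/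
theorem hGB33 {C : Fin 30 → ModularForm (Gamma0 132) 2}
    (hi : ∀ n < 482, (((tabsDeep 1).getD n 0 : ℤ) : ℂ) = (qExpansion 1 ⇑(C 1)).coeff n)
    (hj : ∀ n < 482, (((tabsDeep 4).getD n 0 : ℤ) : ℂ) = (qExpansion 1 ⇑(C 4)).coeff n) :
    ∀ n < 482, (((pTB 33).getD n 0 : ℤ) : ℂ) = (qExpansion 1 ⇑((C 1).mul (C 4))).coeff n := by
  rw [← hpTB33]; exact qExpansion_coeff_mul_eq_mulList (C 1) (C 4) hi hj

/-- `pTB 34 = tabsDeep 1 * tabsDeep 5` below `482` (kernel `decide`). [folklore] -/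
theorem hpTB34 : mulList 482 (tabsDeep 1) (tabsDeep 5) = pTB 34 := by
  decide +kernel

/-- The table `pTB 34` agrees below `482` with the `q`-expansion of the weight-`4` form `C_1·C_5`. [folklore] -/
theorem hGB34 {C : Fin 30 → ModularForm (Gamma0 132) 2}
    (hi : ∀ n < 482, (((tabsDeep 1).getD n 0 : ℤ) : ℂ) = (qExpansion 1 ⇑(C 1)).coeff n)
    (hj : ∀ n < 482, (((tabsDeep 5).getD n 0 : ℤ) : ℂ) = (qExpansion 1 ⇑(C 5)).coeff n) :
    ∀ n < 482, (((pTB 34).getD n 0 : ℤ) : ℂ) = (qExpansion 1 ⇑((C 1).mul (C 5))).coeff n := by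
  rw [← hpTB34]; exact qExpansion_coeff_mul_eq_mulList (C 1) (C 5) hi hj

/-- `pTB 35 = tabsDeep 1 * tabsDeep 6` below `482` (kernel `decide`). [folklore] -/
theorem hpTB35 : mulList 482 (tabsDeep 1) (tabsDeep 6) = pTB 35 := by
  decide +kernel

/-- The table `pTB 35` agrees below `482` with the `q`-expansion of the weight-`4` form `C_1·C_6`. [folklore] -/
theorem hGB35 {C : Fin 30 → ModularForm (Gamma0 132) 2}
    (hi : ∀ n < 482, (((tabsDeep 1).getD n 0 : ℤ) : ℂ) = (qExpansion 1 ⇑(C 1)).coeff n)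
    (hj : ∀ n < 482, (((tabsDeep 6).getD n 0 : ℤ) : ℂ) = (qExpansion 1 ⇑(C 6)).coeff n) :
    ∀ n < 482, (((pTB 35).getD n 0 : ℤ) : ℂ) = (qExpansion 1 ⇑((C 1).mul (C 6))).coeff n := by
  rw [← hpTB35]; exact qExpansion_coeff_mul_eq_mulList (C 1) (C 6) hi hj

/-- `pTB 36 = tabsDeep 1 * tabsDeep 7` below `482` (kernel `decide`). [folklore] -/
theorem hpTB36 : mulList 482 (tabsDeep 1) (tabsDeep 7) = pTB 36 := by
  decide +kernel

/-- The table `pTB 36` agrees below `482` with the `q`-expansion of the weight-`4` form `C_1·C_7`. [folklore] -/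
theorem hGB36 {C : Fin 30 → ModularForm (Gamma0 132) 2}
    (hi : ∀ n < 482, (((tabsDeep 1).getD n 0 : ℤ) : ℂ) = (qExpansion 1 ⇑(C 1)).coeff n)
    (hj : ∀ n < 482, (((tabsDeep 7).getD n 0 : ℤ) : ℂ) = (qExpansion 1 ⇑(C 7)).coeff n) :
    ∀ n < 482, (((pTB 36).getD n 0 : ℤ) : ℂ) = (qExpansion 1 ⇑((C 1).mul (C 7))).coeff n := by
  rw [← hpTB36]; exact qExpansion_coeff_mul_eq_mulList (C 1) (C 7) hi hj

/-- `pTB 37 = tabsDeep 1 * tabsDeep 8` below `482` (kernel `decide`). [folklore] -/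
theorem hpTB37 : mulList 482 (tabsDeep 1) (tabsDeep 8) = pTB 37 := by
  decide +kernel

/-- The table `pTB 37` agrees below `482` with the `q`-expansion of the weight-`4` form `C_1·C_8`. [folklore] -/
theorem hGB37 {C : Fin 30 → ModularForm (Gamma0 132) 2}
    (hi : ∀ n < 482, (((tabsDeep 1).getD n 0 : ℤ) : ℂ) = (qExpansion 1 ⇑(C 1)).coeff n)
    (hj : ∀ n < 482, (((tabsDeep 8).getD n 0 : ℤ) : ℂ) = (qExpansion 1 ⇑(C 8)).coeff n) :
    ∀ n < 482, (((pTB 37).getD n 0 : ℤ) : ℂ) = (qExpansion 1 ⇑((C 1).mul (C 8))).coeff n := by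
  rw [← hpTB37]; exact qExpansion_coeff_mul_eq_mulList (C 1) (C 8) hi hj

/-- `pTB 38 = tabsDeep 1 * tabsDeep 9` below `482` (kernel `decide`). [folklore] -/
theorem hpTB38 : mulList 482 (tabsDeep 1) (tabsDeep 9) = pTB 38 := by
  decide +kernel

/-- The table `pTB 38` agrees below `482` with the `q`-expansion of the weight-`4` form `C_1·C_9`. [folklore] -/
theorem hGB38 {C : Fin 30 → ModularForm (Gamma0 132) 2}
    (hi : ∀ n < 482, (((tabsDeep 1).getD n 0 : ℤ) : ℂ) = (qExpansion 1 ⇑(C 1)).coeff n)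
    (hj : ∀ n < 482, (((tabsDeep 9).getD n 0 : ℤ) : ℂ) = (qExpansion 1 ⇑(C 9)).coeff n) :
    ∀ n < 482, (((pTB 38).getD n 0 : ℤ) : ℂ) = (qExpansion 1 ⇑((C 1).mul (C 9))).coeff n := by
  rw [← hpTB38]; exact qExpansion_coeff_mul_eq_mulList (C 1) (C 9) hi hj


end Summit.BirchSwinnertonDyer.BirchSwinnertonDyer.Theorems.ManinLocalTwoThree.LevelOneThirtyTwo

end
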